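import Summits.QuantumFields.YangMills.Theorems.BalabanLadderROTOfKing
import HarnessLib

/-!
# Birth skeleton v4 «king-limit» — crux `ROT` (stmt-QuantumFields-20042, rank 6) of route-QuantumFields-BalabanLadder

Owner: ym-beyond-p2 (g20), 2026-08-26.  Supersedes v3 (ff3050db3a1215f0, stubs `stub_king : KingAll`, `stub_uvExtract : UVExtract`).
What changed since v3 (all by fleet seat ★ ym-spine-20042-p1, ACCEPTED): p445100 `Theorems/BalabanLadderROTDefs.lean` (the v3
vocabulary verbatim under `Summit.QuantumFields.YangMills.Theorems.ROT`), p446351 `Theorems/BalabanLadderROTUVExtract.lean`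
(**`stub_uvExtract : UVExtract` PROVED** — UV sequential compactness off the diagonal from `MomentBounds6`), p446762
`Theorems/BalabanLadderROTOfKing.lean` (`rot_of_kingAll`, `rot_of_kingLimit`, and the equivalence, under `UVCompactAt`, of the lattice
King–Ward statement with King-invariance of the off-diagonal limit points), FINDING-20042-stub_king-reading.md 513eabcee8c4ac53
(LINE №57 consumes audit: v3's `stub_king : KingAll` bites nothing of the crux's UV hypothesis and asserts, idly, the decay of the
finite-angle rotation defect in uncalibrated units).

v4 = ONE registered stub, the UV-CONSUMING limit-point form (strictly weaker than `KingAll`: `KingAll → KingLimit` by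
`limitsKingInvariant_of_latticeKingWard`, not conversely), and the kernel-checked composition through the landed `rot_of_kingLimit`:

* `stub_kingLimit : KingLimit` — for every compact simple `G`, every `r`, every positive unit map `a → 0` CARRYING `MomentBounds6 G r a`,
  every off-diagonal limit point `S₁` along every subsequence of every admissible scheme in units `a` is invariant under the rotations of
  the `(x₀,x₁)`-plane by the Pythagorean angles on King's class `KingClass n r₀` (some `r₀ > 0` per scheme), `n ≥ 2`.
  consumes: `MomentBounds6` ↦ (i) the limit points range over a compact set (`stub_uvExtract`, used inside `rot_of_kingLimit` to turn
  limit-point invariance into the lattice defect → 0), (ii) `OffDiagDensity` of every limit point (King's density step).  Located content: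
  C. King, CMP 103 (1986) II, Thm 2.4 via Thm 4.2 (two-orientation two-cutoff comparison of Bałaban effective actions; abelian Higgs
  d = 2, 3 in print; YM₄ unprinted — [corpus: rivasseau1991 p.257] «the limit is not necessarily unique … requires further work»).  XXL.
* `ROT_of : Theses.BalabanLadder.ROT := Theorems.ROT.rot_of_kingLimit stub_kingLimit`.

`KingLimit` is defined here verbatim as the hypothesis of the landed `rot_of_kingLimit` (a bare-identifier copy may be appended to the
Theorems Defs by the seat; the registry matches the stub by name + signature).
-/

set_option autoImplicit false

noncomputable section

open scoped SchwartzMap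
open MeasureTheory Filter Topology
open Literature.MathematicalPhysics.QuantumFieldTheory Literature.MathematicalPhysics.QuantumLattice
open Literature.MathematicalPhysics.AQFT Literature.Probability.LatticeModels
open Summit.QuantumFields.YangMills.Cruxes.OSLegsFromFemtoAndGap.DlrCollarTransfer
open Summit.QuantumFields.YangMills.Cruxes.OSLegsAtWeakCouplingC.Sketch
open Summit.QuantumFields.YangMills.Cruxes.OSLegsAtWeakCouplingC.Y2Bridge
open Summit.QuantumFields.YangMills.Theorems.OSLegsFromFemtoAndGap (latticeDist)
open Summit.QuantumFields.YangMills.Theorems.NPointIsotropy.Negative (E4)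
open Summit.QuantumFields.YangMills.Theorems.ROT

namespace Summit.QuantumFields.YangMills.Cruxes.ROT.BirthV4

/-- **King-invariance of the UV limit points** (the registered residual of crux `ROT`, v4): verbatim the hypothesis of the landed
`Summit.QuantumFields.YangMills.Theorems.ROT.rot_of_kingLimit`. -/
def KingLimit : Prop :=
  ∀ (G : Type) [Group G] [TopologicalSpace G] [IsTopologicalGroup G] [CompactSpace G],
    IsCompactSimpleLieGroup G → letI : MeasurableSpace G := borel G; haveI : BorelSpace G := ⟨rfl⟩;
    ∀ (r : LatticeRep G) (a : ℝ → ℝ), (∀ β, 0 < a β) → Tendsto a atTop (𝓝 0) → MomentBounds6 G r a →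
      ∀ sch : SpeciesScheme (YMSpecies G), IsLegScheme a sch → ∃ r₀ : ℝ, 0 < r₀ ∧
        ∀ φ : ℕ → ℕ, Tendsto φ atTop atTop → ∀ S₁ : SchwingerFamily E4, OffDiagLimitAlong r sch φ S₁ →
          ∀ (n : ℕ), 2 ≤ n → ∀ F ∈ King.KingClass n r₀, ∀ θ ∈ (King.pythagoreanAngles : Set ℝ),
            S₁ n (linActMulti (planeRot (0 : Fin 3) θ) F) = S₁ n F

/-- **stub (XXL, the registered residual of `ROT`)**: King-invariance of the UV limit points along `MomentBounds6`-controlled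
sequences.  [C. King, CMP 103 (1986) Thm 2.4 — mechanism; unprinted for YM₄] -/
theorem stub_kingLimit : KingLimit := by
  sorry

/-- **Composition (kernel-checked, no sorry of its own)**: the crux `ROT` of route-QuantumFields-BalabanLadder from the single stub,
through the landed `rot_of_kingLimit` (which supplies UV compactness by the PROVED `stub_uvExtract` and King's density upgrade at
the dense subgroup generated by the Pythagorean angles). -/
theorem ROT_of : Summit.QuantumFields.YangMills.Theses.BalabanLadder.ROT :=
  rot_of_kingLimit stub_kingLimit

end Summit.QuantumFields.YangMills.Cruxes.ROT.BirthV4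

end
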